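import Summits.HubbardSuperconductivity.HubbardSuperconductivity.Theorems.KLProgrammeKLRegimeScaleZeroCovarianceFarSiteExpRing
import Summits.HubbardSuperconductivity.HubbardSuperconductivity.Theorems.KLProgrammeKLRegimeFlowReadScaleZeroSunsetFarRows

/-!
# Route `KLProgramme`, crux K3 — engine-flow child (stmt-HubbardSuperconductivity-20437), stub (C) at `n = 0`, located item #22a «(C)-SCALE0-PT2»,
# the FAR-SITE supplier, HIGH SHELL: the per-frequency weighted far ℓ² `Φ_high(ω)` from p1 g21's strip door — certificate-free

Seat hubbard-kl-k3c5-p1 (g14; owner of #22a).  Design of record TWO SHELLS ((R215)): the far rows come from `…SunsetFarRowsL2.farRows_le_of_l2Far` once, for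
every Matsubara frequency `ω_i`, the weighted far ℓ² of the finite-torus Fourier inverse of the spatial symbol is bounded by some `Φ i`.  On the CUTOFF-FREE
shell `|ω| ≥ klE0` this `Φ` is EXPLICIT and needs no certificate: p1 g21's door `…StripDecaySample.norm_torusFourierInv_uvSpatialSample_le_exp`
(`‖TFI_ω(z̄)‖ ≤ 25·(2/|ω|)·e^{−κ‖z‖∞}`, `κ = arsinh(|ω|/4)`, centred `z`, `e^{−κL/2} ≤ 1/2`) squared, the weight `√(|z₀|²+|z₁|²)ᵏ ≤ 2ᵏ(1+‖z‖∞)ᵏ`, the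
injection `u ↦ z_c(u)` into `ℤ²`, and the lattice ring sum `…FarSiteExpRing.tsum_far_pow_mul_exp_le`:
**`l2Far_high_of_strip`**: `Σ_{u ≠ 0, z_c(u) ∉ disk} √(…)ᵏ‖TFI_ω(u)‖² ≤ 2ᵏ·(50/|ω|)²·max(1,2k/κ)ᵏ·e^{−κ(Rc+1)}·(1+2/(1−e^{−κ/4}))²` — exactly the `hΦ i` shape of
`farRows_le_of_l2Far` at `ω = ω_i`.  The LOW shell (`|ω| < ω₁`, χ₂ active) supplies its `Φ` from the kit's Plancherel-complement certificate (next files).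

No definitions; nothing here asserts (C), any stub of 20437, K3 or superconductivity.
References: BGM 2006 §2.2 footnote 1, §3 (3.2) [cite: BenfattoGiulianiMastropietro2006]; Glimm–Jaffe Prop. 7.3.1 [cite: GlimmJaffeQP1987].
-/

noncomputable section

namespace Summit.HubbardSuperconductivity.HubbardSuperconductivity.Theorems.KLRegimeSplit

set_option linter.dupNamespace false -- summit = problem name (single-conjunct summit), D-0017

open Literature.MathematicalPhysics.QuantumLattice Literature.Probability.LatticeModels Literature.Analysis.FunctionSpaces
open Summit.HubbardSuperconductivity.HubbardSuperconductivity.Theorems.DispersionFlow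
open MeasureTheory Set Finset Complex Real
open scoped Nat

variable {L : ℕ} [NeZero L]

/-- **HIGH-SHELL FAR ℓ² FROM THE STRIP DOOR** (bare frame; `klE0 ≤ |ω|`, `e^{−κL/2} ≤ 1/2` with `κ = arsinh(|ω|/4)`; any record `c` — only `Rc` matters; `k : Fin 3`):
the weighted far ℓ² of the finite-torus Fourier inverse of the scale-0 spatial symbol at frequency `ω` is
`≤ 2ᵏ·(25·(2/|ω|))²·[max(1, 2k/κ)ᵏ·e^{−κ(Rc+1)}·(1 + 2/(1 − e^{−κ/4}))²]`. -/
theorem l2Far_high_of_strip (c : SunsetCellRecordV2) (μ : ℝ) {om : ℝ} (hom : klE0 ≤ |om|)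
    (hρ : Real.exp (-(Real.arsinh (|om| / 4) * L / 2)) ≤ 1 / 2) (k : Fin 3) :
    ∑ u : TorusSite 2 L,
      (if u ≠ 0 ∧ (fun j => (u j).valMinAbs : Site 2) ∉ c.disk then
        Real.sqrt ((((u 0).valMinAbs.natAbs : ℝ)) ^ 2 + (((u 1).valMinAbs.natAbs : ℝ)) ^ 2) ^ (k : ℕ) *
          ‖torusFourierInv (fun kv : TorusSite 2 L =>
            (fun y : Momentum => uvSymbolFn 1 klE0 (frameLevel μ 0 ((2 * π) • y)) om)
              (WithLp.toLp 2 fun j => ((kv j).val : ℝ) / L)) u‖ ^ 2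
        else 0) ≤
      2 ^ (k : ℕ) * (25 * (2 / |om|)) ^ 2 *
        ((max 1 ((2 * (k : ℕ) : ℝ) / Real.arsinh (|om| / 4))) ^ (k : ℕ) * Real.exp (-(Real.arsinh (|om| / 4) * (c.Rc + 1))) *
          (1 + 2 * (1 - Real.exp (-(Real.arsinh (|om| / 4) / 4)))⁻¹) ^ 2) := by
  classical
  have hE0 : (0 : ℝ) < klE0 := by norm_num [klE0]
  have hom0' : 0 < |om| := hE0.trans_le hom
  set κ : ℝ := Real.arsinh (|om| / 4) with hκ
  have hκ0 : 0 < κ := Real.arsinh_pos_iff.2 (by positivity)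
  -- the summand family on `ℤ²` and its ring bound
  obtain ⟨hsum, hring⟩ := tsum_far_pow_mul_exp_le hκ0 (k : ℕ) c.Rc
  set g : Site 2 → ℝ := fun z => if (c.Rc : ℝ) < ‖z‖ then (1 + ‖z‖) ^ (k : ℕ) * Real.exp (-(2 * κ * ‖z‖)) else 0 with hg
  have hg0 : ∀ z, 0 ≤ g z := fun z => by simp only [hg]; split_ifs <;> positivity
  -- centred representative
  set zc : TorusSite 2 L → Site 2 := fun u => fun j => (u j).valMinAbs with hzc
  have hproj : ∀ u : TorusSite 2 L, Torus.proj L (zc u) = u := fun u => (two_mul_norm_valMinAbs_le u).1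
  have hzcL : ∀ u : TorusSite 2 L, 2 * ‖zc u‖ ≤ L := fun u => (two_mul_norm_valMinAbs_le u).2
  have hzc0 : ∀ u : TorusSite 2 L, u ≠ 0 → zc u ≠ 0 := by
    intro u hu h0
    apply hu
    have h := hproj u
    rw [h0] at h
    have : Torus.proj L (0 : Site 2) = 0 := by funext j; simp [Literature.Probability.LatticeModels.Torus.proj_apply]
    rw [this] at h
    exact h.symm
  -- per site: the door squared, the weight, the far indicator
  have hsite : ∀ u : TorusSite 2 L,
      (if u ≠ 0 ∧ (fun j => (u j).valMinAbs : Site 2) ∉ c.disk then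
        Real.sqrt ((((u 0).valMinAbs.natAbs : ℝ)) ^ 2 + (((u 1).valMinAbs.natAbs : ℝ)) ^ 2) ^ (k : ℕ) *
          ‖torusFourierInv (fun kv : TorusSite 2 L =>
            (fun y : Momentum => uvSymbolFn 1 klE0 (frameLevel μ 0 ((2 * π) • y)) om)
              (WithLp.toLp 2 fun j => ((kv j).val : ℝ) / L)) u‖ ^ 2
        else 0) ≤ 2 ^ (k : ℕ) * (25 * (2 / |om|)) ^ 2 * g (zc u) := by
    intro u
    by_cases hcond : u ≠ 0 ∧ (fun j => (u j).valMinAbs : Site 2) ∉ c.disk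
    · rw [if_pos hcond]
      have hfar : (c.Rc : ℝ) < ‖zc u‖ := by
        have h := one_add_norm_ge_of_not_mem_disk c (hzc0 u hcond.1) hcond.2
        linarith
      have hgz : g (zc u) = (1 + ‖zc u‖) ^ (k : ℕ) * Real.exp (-(2 * κ * ‖zc u‖)) := by simp only [hg]; exact if_pos hfar
      rw [hgz]
      -- the door at the centred representative
      have hdoor : ‖torusFourierInv (fun kv : TorusSite 2 L =>
            (fun y : Momentum => uvSymbolFn 1 klE0 (frameLevel μ 0 ((2 * π) • y)) om)
              (WithLp.toLp 2 fun j => ((kv j).val : ℝ) / L)) u‖ ≤ 25 * (2 / |om|) * Real.exp (-(κ * ‖zc u‖)) := by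
        have h := norm_torusFourierInv_uvSpatialSample_le_exp hE0 μ hom (hzcL u) hρ
        rwa [hproj u] at h
      have hn0 := norm_nonneg (torusFourierInv (fun kv : TorusSite 2 L =>
            (fun y : Momentum => uvSymbolFn 1 klE0 (frameLevel μ 0 ((2 * π) • y)) om)
              (WithLp.toLp 2 fun j => ((kv j).val : ℝ) / L)) u)
      have hsq : ‖torusFourierInv (fun kv : TorusSite 2 L =>
            (fun y : Momentum => uvSymbolFn 1 klE0 (frameLevel μ 0 ((2 * π) • y)) om)
              (WithLp.toLp 2 fun j => ((kv j).val : ℝ) / L)) u‖ ^ 2 ≤ (25 * (2 / |om|)) ^ 2 * Real.exp (-(2 * κ * ‖zc u‖)) := by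
        calc _ ≤ (25 * (2 / |om|) * Real.exp (-(κ * ‖zc u‖))) ^ 2 := pow_le_pow_left₀ hn0 hdoor 2
          _ = (25 * (2 / |om|)) ^ 2 * Real.exp (-(2 * κ * ‖zc u‖)) := by
              rw [mul_pow, sq (Real.exp _), ← Real.exp_add]; congr 1; congr 1; ring
      -- the weight
      have hw : Real.sqrt ((((u 0).valMinAbs.natAbs : ℝ)) ^ 2 + (((u 1).valMinAbs.natAbs : ℝ)) ^ 2) ^ (k : ℕ) ≤ 2 ^ (k : ℕ) * (1 + ‖zc u‖) ^ (k : ℕ) := by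
        rw [← mul_pow]; exact pow_le_pow_left₀ (Real.sqrt_nonneg _) (sqrt_natAbs_sq_le (zc u)) _
      calc _ ≤ (2 ^ (k : ℕ) * (1 + ‖zc u‖) ^ (k : ℕ)) * ((25 * (2 / |om|)) ^ 2 * Real.exp (-(2 * κ * ‖zc u‖))) :=
            mul_le_mul hw hsq (by positivity) (by positivity)
        _ = 2 ^ (k : ℕ) * (25 * (2 / |om|)) ^ 2 * ((1 + ‖zc u‖) ^ (k : ℕ) * Real.exp (-(2 * κ * ‖zc u‖))) := by ring
    · rw [if_neg hcond]; exact mul_nonneg (by positivity) (hg0 _)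
  refine (Finset.sum_le_sum fun u _ => hsite u).trans ?_
  rw [← Finset.mul_sum]
  refine mul_le_mul_of_nonneg_left ?_ (by positivity)
  -- the injection into `ℤ²` and the ring sum
  have hinj : Function.Injective zc := fun u v huv => by
    have h := congrArg (Torus.proj L) huv
    rwa [hproj u, hproj v] at h
  calc ∑ u : TorusSite 2 L, g (zc u) = ∑ z ∈ (Finset.univ : Finset (TorusSite 2 L)).image zc, g z := by
        rw [Finset.sum_image fun u _ v _ h => hinj h]
    _ ≤ ∑' z : Site 2, g z := hsum.sum_le_tsum _ fun z _ => hg0 z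
    _ ≤ _ := hring

end Summit.HubbardSuperconductivity.HubbardSuperconductivity.Theorems.KLRegimeSplit

end
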